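import Summits.CriticalPhenomena.CardyFormulaZ2.Theorems.CardyRotToConfR2SymmetryUpgrade.Negative.CurveTransport
import Literature.Probability.RandomPlanarGeometry.ConformalRestrictionProofs

/-!
# Transport of structure along a plane homeomorphism (stub `stub_conjTransport`, line
`isotropy-kills-beltrami`, crux `CardyRotToConfR2SymmetryUpgrade`, stmt-CriticalPhenomena-0698)

Conjugating a chordal curve family `P` by ANY homeomorphism `Φ : ℂ ≃ₜ ℂ` of the plane,
`Q D := Φ_* (P (Φ⁻¹ D)) = (P (D.map Φ.symm)).map (CurveClass.map Φ)`, preserves the four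
topological axioms of the bundle `IsLocalMarkovChordalFamily` — chordality
(`ChordalFamily.IsChordal`), the typed domain Markov property (`IsDomainMarkov`, with the
transported kernel `Q' D p := Φ_* Q (Φ⁻¹ D) (Φ⁻¹_* p)`), locality in restriction form (`IsLocal`)
and target independence (`IsTargetIndependent`) — and the non-tracing clause. Similarity
covariance is NOT transported here.

This is the general-homeomorphism version of
`Theorems/CardyRotToConfR2SymmetryUpgrade/Negative/ConjTransport.lean` (there `Φ` is complex
conjugation, an involution); the proofs follow that file line by line with the pair
`(Φ, Φ.symm)` in place of the involution:
* `CurveClass.map Φ` is a measurable embedding with two-sided inverse `CurveClass.map Φ.symm`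
  (`measurableEmbedding_curveClassMap`), so push-forward laws are evaluated on ARBITRARY sets
  (`MeasurableEmbedding.map_apply`; the events `CurveClass.stopAt F ⁻¹' T` are not known to be
  measurable) and set-integrals move by `MeasurableEmbedding.restrict_map` / `lintegral_map`;
* curve surgery (`stopAt`, `startFrom`) and the remaining domain commute with `Φ`
  (`curveClass_stopAt_map`, `curveClass_startFrom_map`, `remainingDomain_map` of
  `Negative/CurveTransport.lean`), frontiers / closures / set differences / arcs / marked points
  are transported by `Φ` (`Homeomorph.image_frontier`, `image_closure`, `Set.image_sdiff`,
  `MarkedDomain.arc_map`, `pt_map`).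
-/

noncomputable section

open Set MeasureTheory Topology Filter
open scoped unitInterval ENNReal NNReal

namespace Summit.CriticalPhenomena.CardyFormulaZ2.Theorems.CardyRotToConfR2SymmetryUpgrade.IsotropyKillsBeltrami

open Literature.Probability.RandomPlanarGeometry
open Literature.Probability.RandomPlanarGeometry.ChordalFamily
open Summit.CriticalPhenomena.CardyFormulaZ2.Theorems.CardyRotToConfR2SymmetryUpgrade.Negative

/-! ### `CurveClass.map Φ` is a Borel bijection with inverse `CurveClass.map Φ⁻¹` -/

/-- Pushing a curve forward along `Φ` and then along `Φ⁻¹` gives it back. -/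
theorem curve_map_map_symm (Φ : ℂ ≃ₜ ℂ) (γ : Curve ℂ) :
    (γ.map (Φ : C(ℂ, ℂ))).map (Φ.symm : C(ℂ, ℂ)) = γ :=
  Curve.ext (ContinuousMap.ext fun t => by simp)

/-- Pushing a curve forward along `Φ⁻¹` and then along `Φ` gives it back. -/
theorem curve_map_symm_map (Φ : ℂ ≃ₜ ℂ) (γ : Curve ℂ) :
    (γ.map (Φ.symm : C(ℂ, ℂ))).map (Φ : C(ℂ, ℂ)) = γ :=
  Curve.ext (ContinuousMap.ext fun t => by simp)

/-- `Φ⁻¹_* (Φ_* c) = c` on curve classes. -/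
theorem curveClassMap_symm_map (Φ : ℂ ≃ₜ ℂ) (c : CurveClass ℂ) :
    CurveClass.map (Φ.symm : C(ℂ, ℂ)) (CurveClass.map (Φ : C(ℂ, ℂ)) c) = c := by
  obtain ⟨γ, rfl⟩ := CurveClass.surjective_mk c
  rw [CurveClass.map_mk, CurveClass.map_mk, curve_map_map_symm]

/-- `Φ_* (Φ⁻¹_* c) = c` on curve classes. -/
theorem curveClassMap_map_symm (Φ : ℂ ≃ₜ ℂ) (c : CurveClass ℂ) :
    CurveClass.map (Φ : C(ℂ, ℂ)) (CurveClass.map (Φ.symm : C(ℂ, ℂ)) c) = c := by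
  obtain ⟨γ, rfl⟩ := CurveClass.surjective_mk c
  rw [CurveClass.map_mk, CurveClass.map_mk, curve_map_symm_map]

/-- Images under `Φ_*` are preimages under `Φ⁻¹_*`. -/
theorem curveClassMap_image_eq_preimage_symm (Φ : ℂ ≃ₜ ℂ) (A : Set (CurveClass ℂ)) :
    CurveClass.map (Φ : C(ℂ, ℂ)) '' A = CurveClass.map (Φ.symm : C(ℂ, ℂ)) ⁻¹' A := by
  ext c
  constructor
  · rintro ⟨w, hw, rfl⟩
    show CurveClass.map (Φ.symm : C(ℂ, ℂ)) (CurveClass.map (Φ : C(ℂ, ℂ)) w) ∈ A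
    rwa [curveClassMap_symm_map]
  · intro hc
    exact ⟨_, hc, curveClassMap_map_symm Φ c⟩

/-- **Push-forward of curve classes along a plane homeomorphism is a measurable embedding**
(a Borel bijection with Borel inverse), so `(μ.map Φ_*) s = μ (Φ_* ⁻¹' s)` for EVERY set `s`
(`MeasurableEmbedding.map_apply`). -/
theorem measurableEmbedding_curveClassMap (Φ : ℂ ≃ₜ ℂ) :
    MeasurableEmbedding (CurveClass.map (Φ : C(ℂ, ℂ))) where
  injective := Function.LeftInverse.injective (curveClassMap_symm_map Φ)
  measurable := CurveClass.measurable_map _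
  measurableSet_image' := fun s hs => by
    rw [curveClassMap_image_eq_preimage_symm]
    exact hs.preimage (CurveClass.measurable_map _)

/-- The push-forward law of a set is the original law of its `Φ_*`-preimage (no measurability
needed). -/
theorem map_curveClassMap_apply (Φ : ℂ ≃ₜ ℂ) (μ : Measure (CurveClass ℂ))
    (A : Set (CurveClass ℂ)) :
    μ.map (CurveClass.map (Φ : C(ℂ, ℂ))) A = μ (CurveClass.map (Φ : C(ℂ, ℂ)) ⁻¹' A) :=
  (measurableEmbedding_curveClassMap Φ).map_apply μ A

/-- Almost-sure statements transfer through the push-forward along `Φ_*`. -/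
theorem ae_map_curveClassMap_iff (Φ : ℂ ≃ₜ ℂ) {μ : Measure (CurveClass ℂ)}
    {q : CurveClass ℂ → Prop} :
    (∀ᵐ γ ∂(μ.map (CurveClass.map (Φ : C(ℂ, ℂ)))), q γ) ↔
      ∀ᵐ γ ∂μ, q (CurveClass.map (Φ : C(ℂ, ℂ)) γ) :=
  (measurableEmbedding_curveClassMap Φ).ae_map_iff

/-- Preimage of a stopped-curve event under `Φ_*` (closed `F`). -/
theorem curveClassMap_preimage_stopAt (Φ : ℂ ≃ₜ ℂ) {F : Set ℂ} (hF : IsClosed F)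
    (T : Set (CurveClass ℂ)) :
    CurveClass.map (Φ : C(ℂ, ℂ)) ⁻¹' (CurveClass.stopAt F ⁻¹' T) =
      CurveClass.stopAt (Φ ⁻¹' F) ⁻¹' (CurveClass.map (Φ : C(ℂ, ℂ)) ⁻¹' T) := by
  ext c
  simp only [Set.mem_preimage, curveClass_stopAt_map _ hF]
  rfl

/-- Preimage of a final-segment event under `Φ_*` (closed `F`). -/
theorem curveClassMap_preimage_startFrom (Φ : ℂ ≃ₜ ℂ) {F : Set ℂ} (hF : IsClosed F)
    (T : Set (CurveClass ℂ)) :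
    CurveClass.map (Φ : C(ℂ, ℂ)) ⁻¹' (CurveClass.startFrom F ⁻¹' T) =
      CurveClass.startFrom (Φ ⁻¹' F) ⁻¹' (CurveClass.map (Φ : C(ℂ, ℂ)) ⁻¹' T) := by
  ext c
  simp only [Set.mem_preimage, curveClass_startFrom_map _ hF]
  rfl

/-! ### Transport of each axiom along `Φ` -/

/-! The conjugate family of `P` along `Φ` is written out in full below as
`fun D : DobrushinDomain => (P (D.map Φ.symm)).map (CurveClass.map (Φ : C(ℂ, ℂ)))`, i.e.
`D ↦ Φ_* (P (Φ⁻¹ D))`. -/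

/-- Transport of chordality along a plane homeomorphism. -/
theorem isChordal_homeoTransport (Φ : ℂ ≃ₜ ℂ) {P : ChordalFamily} (h : P.IsChordal) :
    ChordalFamily.IsChordal
      (fun D : DobrushinDomain => (P (D.map Φ.symm)).map (CurveClass.map (Φ : C(ℂ, ℂ)))) := by
  intro D
  obtain ⟨hprob, hae⟩ := h (D.map Φ.symm)
  refine ⟨⟨by rw [map_curveClassMap_apply, Set.preimage_univ, measure_univ]⟩, ?_⟩
  rw [ae_map_curveClassMap_iff]
  filter_upwards [hae] with x hx
  obtain ⟨hs, ht, hr⟩ := hx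
  refine ⟨?_, ?_, ?_⟩
  · rw [CurveClass.source_map, hs, MarkedDomain.pt_map]
    exact Φ.apply_symm_apply _
  · rw [CurveClass.target_map, ht, MarkedDomain.pt_map]
    exact Φ.apply_symm_apply _
  · rw [CurveClass.range_map]
    refine (Set.image_mono hr).trans ?_
    change Φ '' closure ((D.map Φ.symm).carrier) ⊆ _
    rw [Φ.image_closure, MarkedDomain.carrier_map, Φ.image_symm, Φ.image_preimage]

/-- Transport of the non-tracing clause along a plane homeomorphism (every representative of
`Φ_* γ` is `Φ ∘ c` for a representative `c` of `γ`; frontiers are transported by `Φ⁻¹`). -/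
theorem nonTracing_homeoTransport (Φ : ℂ ≃ₜ ℂ) {P : ChordalFamily}
    (h : ∀ D : DobrushinDomain, ∀ᵐ γ ∂(P D), ∀ c : Curve ℂ, CurveClass.mk c = γ →
      ∀ s t : unitInterval, s < t → c '' Set.Icc s t ⊆ frontier D.carrier →
        (c '' Set.Icc s t).Subsingleton) :
    ∀ D : DobrushinDomain, ∀ᵐ γ ∂((P (D.map Φ.symm)).map (CurveClass.map (Φ : C(ℂ, ℂ)))),
      ∀ c : Curve ℂ, CurveClass.mk c = γ →
        ∀ s t : unitInterval, s < t → c '' Set.Icc s t ⊆ frontier D.carrier →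
          (c '' Set.Icc s t).Subsingleton := by
  intro D
  rw [ae_map_curveClassMap_iff]
  filter_upwards [h (D.map Φ.symm)] with x hx
  intro c hc s t hst hsub
  have hc' : CurveClass.mk (c.map (Φ.symm : C(ℂ, ℂ))) = x := by
    rw [← CurveClass.map_mk, hc, curveClassMap_symm_map]
  have himage : (c.map (Φ.symm : C(ℂ, ℂ))) '' Set.Icc s t = Φ.symm '' (c '' Set.Icc s t) := by
    rw [Set.image_image]
    rfl
  have h1 := hx _ hc' s t hst (by
    rw [himage, MarkedDomain.carrier_map, ← Φ.symm.image_frontier]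
    exact Set.image_mono hsub)
  rw [himage] at h1
  exact Set.subsingleton_of_image Φ.symm.injective _ h1

/-- Transport of restriction locality along a plane homeomorphism. -/
theorem isLocal_homeoTransport (Φ : ℂ ≃ₜ ℂ) {P : ChordalFamily} (h : P.IsLocal) :
    ChordalFamily.IsLocal
      (fun D : DobrushinDomain => (P (D.map Φ.symm)).map (CurveClass.map (Φ : C(ℂ, ℂ)))) := by
  intro D D' hsub h0 h1 T hT
  have hF : IsClosed (closure (D.carrier \ D'.carrier)) := isClosed_closure
  rw [map_curveClassMap_apply, map_curveClassMap_apply, curveClassMap_preimage_stopAt Φ hF]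
  have hF' : Φ ⁻¹' closure (D.carrier \ D'.carrier) =
      closure ((D.map Φ.symm).carrier \ (D'.map Φ.symm).carrier) := by
    rw [← Φ.image_symm, Φ.symm.image_closure, MarkedDomain.carrier_map,
      MarkedDomain.carrier_map, Set.image_sdiff Φ.symm.injective]
  rw [hF']
  exact h (D.map Φ.symm) (D'.map Φ.symm) (Set.image_mono hsub) (by simp [h0]) (by simp [h1]) _
    (hT.preimage (CurveClass.measurable_map _))

/-- Transport of splitting locality / target independence along a plane homeomorphism. -/
theorem isTargetIndependent_homeoTransport (Φ : ℂ ≃ₜ ℂ) {P : ChordalFamily}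
    (h : P.IsTargetIndependent) :
    ChordalFamily.IsTargetIndependent
      (fun D : DobrushinDomain => (P (D.map Φ.symm)).map (CurveClass.map (Φ : C(ℂ, ℂ)))) := by
  intro D T hT
  rw [map_curveClassMap_apply, map_curveClassMap_apply,
    curveClassMap_preimage_stopAt Φ (D.isClosed_arc 1)]
  have harc : Φ ⁻¹' D.arc 1 = (D.map Φ.symm).arc 1 := by
    rw [MarkedDomain.arc_map, Φ.image_symm]
  rw [harc, ← markedDomain_chord_map, ← markedDomain_chord_map]
  exact h (D.map Φ.symm) _ (hT.preimage (CurveClass.measurable_map _))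

/-- Transport of the domain Markov property along a plane homeomorphism, with kernel
`Q' D p := Φ_* Q (Φ⁻¹ D) (Φ⁻¹_* p)`. -/
theorem isDomainMarkov_homeoTransport (Φ : ℂ ≃ₜ ℂ) {P : ChordalFamily} (h : P.IsDomainMarkov) :
    ChordalFamily.IsDomainMarkov
      (fun D : DobrushinDomain => (P (D.map Φ.symm)).map (CurveClass.map (Φ : C(ℂ, ℂ)))) := by
  obtain ⟨Q, hQ⟩ := h
  refine ⟨fun D p => (Q (D.map Φ.symm) (CurveClass.map (Φ.symm : C(ℂ, ℂ)) p)).map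
      (CurveClass.map (Φ : C(ℂ, ℂ))), ?_, ?_, ?_⟩
  · intro D
    have hc : CurveClass.map (Φ.symm : C(ℂ, ℂ)) (CurveClass.mk (Curve.const (D.pt 0))) =
        CurveClass.mk (Curve.const ((D.map Φ.symm).pt 0)) := by
      rw [CurveClass.map_mk, MarkedDomain.pt_map]
      rfl
    rw [hc, hQ.initial]
  · intro D F hF S T hS hT
    have hF' : IsClosed (Φ ⁻¹' F) := hF.preimage Φ.continuous
    rw [map_curveClassMap_apply, Set.preimage_inter, curveClassMap_preimage_stopAt Φ hF,
      curveClassMap_preimage_startFrom Φ hF,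
      hQ.markov (D.map Φ.symm) _ hF' _ _ (hS.preimage (CurveClass.measurable_map _))
        (hT.preimage (CurveClass.measurable_map _))]
    change _ = ∫⁻ γ in CurveClass.stopAt F ⁻¹' S,
      (Q (D.map Φ.symm) (CurveClass.map (Φ.symm : C(ℂ, ℂ)) (CurveClass.stopAt F γ))).map
          (CurveClass.map (Φ : C(ℂ, ℂ))) T
        ∂((P (D.map Φ.symm)).map (CurveClass.map (Φ : C(ℂ, ℂ))))
    rw [(measurableEmbedding_curveClassMap Φ).restrict_map,
      (measurableEmbedding_curveClassMap Φ).lintegral_map, curveClassMap_preimage_stopAt Φ hF]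
    refine lintegral_congr fun γ => ?_
    rw [map_curveClassMap_apply, curveClass_stopAt_map _ hF, curveClassMap_symm_map]
    rfl
  · intro D₁ D₂ p₁ p₂ hrem htip hb
    rw [hQ.domain (D₁.map Φ.symm) (D₂.map Φ.symm) (CurveClass.map (Φ.symm : C(ℂ, ℂ)) p₁)
      (CurveClass.map (Φ.symm : C(ℂ, ℂ)) p₂)
      (by rw [remainingDomain_map, remainingDomain_map, hrem])
      (by rw [CurveClass.target_map, CurveClass.target_map, htip])
      (by rw [MarkedDomain.pt_map, MarkedDomain.pt_map, hb])]

/-! ### The registered stub -/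

/-- Registered stub `stub_conjTransport` (S2 · TRANSPORT OF STRUCTURE) of line
`isotropy-kills-beltrami` for crux `CardyRotToConfR2SymmetryUpgrade` (stmt-CriticalPhenomena-0698).
Conjugating a chordal family by ANY plane homeomorphism `Φ` (`D ↦ Φ_* P(Φ⁻¹D)`,
`Φ⁻¹D = D.map Φ.symm`) preserves the four topological axioms of the bundle — chordality, the typed
domain Markov property (kernel `Q' D p := Φ_* Q (Φ⁻¹D) (Φ⁻¹_* p)`; `remainingDomain`, `stopAt`,
`startFrom`, tip and target commute with `Φ`), locality in restriction form and target
independence (arcs of `D.map Φ` are images of arcs, `MarkedDomain.arc_map`) — and the non-tracing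
clause (every representative of `Φ_* γ` is `Φ ∘ c` for a representative `c` of `γ`;
`frontier (Φ⁻¹D) = Φ⁻¹(frontier D)`; `CurveClass.map Φ` is a Borel bijection so null sets
transport). Similarity covariance is NOT transported. -/
theorem stub_conjTransport :
    ∀ (P : ChordalFamily) (Φ : ℂ ≃ₜ ℂ), P.IsChordal → P.IsDomainMarkov → P.IsLocal →
      P.IsTargetIndependent →
      (∀ D : DobrushinDomain, ∀ᵐ γ ∂(P D), ∀ c : Curve ℂ, CurveClass.mk c = γ →
        ∀ s t : unitInterval, s < t → c '' Set.Icc s t ⊆ frontier D.carrier →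
          (c '' Set.Icc s t).Subsingleton) →
      ChordalFamily.IsChordal (fun D : DobrushinDomain => (P (D.map Φ.symm)).map (CurveClass.map (Φ : C(ℂ, ℂ)))) ∧
      ChordalFamily.IsDomainMarkov (fun D : DobrushinDomain => (P (D.map Φ.symm)).map (CurveClass.map (Φ : C(ℂ, ℂ)))) ∧
      ChordalFamily.IsLocal (fun D : DobrushinDomain => (P (D.map Φ.symm)).map (CurveClass.map (Φ : C(ℂ, ℂ)))) ∧
      ChordalFamily.IsTargetIndependent (fun D : DobrushinDomain => (P (D.map Φ.symm)).map (CurveClass.map (Φ : C(ℂ, ℂ)))) ∧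
      (∀ D : DobrushinDomain, ∀ᵐ γ ∂((P (D.map Φ.symm)).map (CurveClass.map (Φ : C(ℂ, ℂ)))), ∀ c : Curve ℂ, CurveClass.mk c = γ →
        ∀ s t : unitInterval, s < t → c '' Set.Icc s t ⊆ frontier D.carrier →
          (c '' Set.Icc s t).Subsingleton) := by
  intro P Φ hch hmk hloc hti hnt
  exact ⟨isChordal_homeoTransport Φ hch, isDomainMarkov_homeoTransport Φ hmk,
    isLocal_homeoTransport Φ hloc, isTargetIndependent_homeoTransport Φ hti,
    nonTracing_homeoTransport Φ hnt⟩

end Summit.CriticalPhenomena.CardyFormulaZ2.Theorems.CardyRotToConfR2SymmetryUpgrade.IsotropyKillsBeltrami
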